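import Mathlib.LinearAlgebra.Projectivization.Cardinality
import Mathlib.Combinatorics.Matroid.Minor.Order
import Mathlib.LinearAlgebra.Dimension.Free
import Mathlib.LinearAlgebra.StdBasis
import Mathlib.LinearAlgebra.Finsupp.Pi
import Mathlib.RingTheory.Finiteness.Cardinality
import Mathlib.Data.Fintype.EquivFin
import Mathlib.Tactic.NormNum
import Literature.Combinatorics.Matroid.VectorMatroid
import Literature.Combinatorics.Matroid.UniformMatroid
import HarnessLib

/-!
# Representable matroids; `U_{2,k}` is `𝔽`-representable iff `|𝔽| ≥ k - 1`

Oxley, *Matroid Theory* (2nd ed., 2011), §1.1 and §6.5.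

A matroid `M` on `α` is **representable over** a division ring `K` (Oxley §1.1, p. 12: "if `M` is
isomorphic to the vector matroid of a matrix `D` over `𝔽`, then `M` is `𝔽`-representable") when it
is the vector matroid (`Literature.Combinatorics.Matroid.vectorMatroid`) of some family of vectors
indexed by `α`.  We fix the ambient space to be `α → K` in the definition (`IsRepresentable`) and
prove that this loses nothing: the vector matroid of *any* family `v : α → W` in *any* `K`-space is
representable in this sense (`vectorMatroid_isRepresentable`, coordinates with respect to a base).

Main results (namespace `Literature.Combinatorics.Matroid`):

* `IsRepresentable K M`, `vectorMatroid_isRepresentable`, `IsRepresentable.restrict`,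
  `IsRepresentable.delete` (restrictions of representable matroids are representable, Oxley 3.1.2),
  `vectorMatroid_contract` (contraction = passing to the quotient by `span (v '' T)`, Prop. 3.2.6),
  `IsRepresentable.contract`, `IsRepresentable.minor` (**Proposition 3.2.4**: minors of representable
  matroids are representable).
* `vectorMatroid_zero_eq_unifOn_zero`, `vectorMatroid_const_eq_unifOn_one`,
  `vectorMatroid_single_eq_freeOn`: `U_{0,n}`, `U_{1,n}` and the free matroid `U_{n,n}` are
  representable over every `K` (Oxley §6.5, p. 206: "if `r ≤ 1`, then evidently `U_{r,n}` is
  `𝔽`-representable for every field `𝔽`").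
* `encard_le_of_vectorMatroid_eq_unifOn_two` — if `U_{2,E}` is a vector matroid over a finite field
  `𝔽` then `|E| ≤ |𝔽| + 1` (the points `⟨v e⟩` are distinct points of a projective line, which has
  `|𝔽| + 1` points: `Projectivization.card_of_finrank_two`).
* `vectorMatroid_lineVectors` — conversely the vectors `(0,1)` and `(1, c_e)` with distinct `c_e`
  represent `U_{2,E}`.
* `unifOn_two_isRepresentable_iff` — **Proposition 6.5.2**: for a field `𝔽` and a finite `E`,
  `U_{2,E}` is `𝔽`-representable iff `|E| ≤ |𝔽| + 1` (with `|𝔽| = ⊤` for infinite `𝔽`, i.e.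
  `E.encard ≤ ENat.card 𝔽 + 1`); `unifOn_two_isRepresentable_iff_of_finite` (finite `𝔽`, any `E`).
* `unifOn_two_not_isRepresentable_and_minors` — the size part of **Corollary 6.5.3**: over `GF(q)`
  the matroid `U_{2,q+2}` is not representable while all its single-element deletions `U_{2,q+1}`
  and contractions `U_{1,q+1}` are; with `Matroid.IsStrictMinor.exists_isMinor_contract_or_delete`
  (a proper minor lies below some `M/e` or `M \ e`, §3.1 p. 101) this gives **Corollary 6.5.3**
  `unifOn_two_isExcludedMinor`: `U_{2,q+2}` is an excluded minor for `GF(q)`-representability.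

## References

* J. Oxley, *Matroid Theory*, 2nd ed., Oxford Graduate Texts in Mathematics 21, OUP 2011,
  §1.1 (p. 12), §3.2 (Prop. 3.2.4, Prop. 3.2.6), §6.5 (Prop. 6.5.2, Cor. 6.5.3, p. 186; p. 206).
  [cite: Oxley2011]
-/

noncomputable section

open Set Submodule

namespace Literature.Combinatorics.Matroid

section IsRepresentable

variable {α K W : Type*} [DivisionRing K] [AddCommGroup W] [Module K W]

/-- A matroid `M` on `α` is **`K`-representable** if it is the vector matroid of a family of vectors
`v : α → (α → K)` on its ground set (Oxley §1.1, p. 12: `M ≅ M[D]` for a matrix `D` over `K`; the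
columns of `D` are the `v e`, `e ∈ M.E`).  Fixing the ambient space `α → K` is harmless by
`vectorMatroid_isRepresentable`. [cite: Oxley2011, §1.1 p. 12] -/
def IsRepresentable (K : Type*) [DivisionRing K] (M : Matroid α) : Prop :=
  ∃ v : α → (α → K), vectorMatroid K v M.E = M

/-- **Every vector matroid is representable** (in the fixed space `α → K`): if `B` is a base of
`vectorMatroid K v E`, taking coordinates with respect to the linearly independent family
`(v b)_{b ∈ B}` (and extending by zero to `α`) is an injective linear map on the span of `v '' E`,
so it preserves the pattern of linear dependencies (Oxley §1.1; cf. Prop. 6.3.12 / standard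
representative matrices `[I_r | D]`, §6.4). [cite: Oxley2011, §1.1 p. 12] -/
theorem vectorMatroid_isRepresentable (v : α → W) (E : Set α) :
    IsRepresentable K (vectorMatroid K v E) := by
  classical
  obtain ⟨B, hB⟩ := (vectorMatroid K v E).exists_isBase
  have hBli : LinearIndependent K (fun x : B => v (x : α)) :=
    ((vectorMatroid_indep_iff v E).1 hB.indep).2
  -- coordinates with respect to `B`, pushed forward into `α → K`
  let φ : span K (range fun x : B => v (x : α)) →ₗ[K] (α → K) :=
    (Finsupp.lcoeFun ∘ₗ Finsupp.lmapDomain K K (Subtype.val : B → α)) ∘ₗ hBli.repr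
  have hφ : Function.Injective φ := by
    intro x y hxy
    simp only [φ, LinearMap.comp_apply, Finsupp.lcoeFun_apply, Finsupp.lmapDomain_apply,
      DFunLike.coe_fn_eq] at hxy
    exact (LinearMap.ker_eq_bot.1 hBli.repr_ker) (Finsupp.mapDomain_injective Subtype.val_injective hxy)
  have hmem : ∀ e ∈ E, v e ∈ span K (range fun x : B => v (x : α)) := by
    intro e he
    rw [← image_eq_range, ← span_image_eq_of_isBasis v E hB.isBasis_ground]
    exact subset_span (mem_image_of_mem v he)
  set v' : α → (α → K) := fun e => if h : e ∈ E then φ ⟨v e, hmem e h⟩ else 0 with hv'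
  refine ⟨v', Matroid.ext_indep rfl fun I (hI : I ⊆ E) => ?_⟩
  rw [vectorMatroid_indep_iff, vectorMatroid_indep_iff]
  refine and_congr_right fun hIE => ?_
  let u : I → span K (range fun x : B => v (x : α)) := fun x => ⟨v x, hmem x (hIE x.2)⟩
  have h1 : LinearIndepOn K v' I ↔ LinearIndependent K u := by
    have h : (fun x : I => v' (x : α)) = φ ∘ u := funext fun x => by
      simp only [hv', Function.comp_apply]
      rw [dif_pos (show (x : α) ∈ E from hIE x.2)]
    unfold LinearIndepOn
    rw [h]
    exact LinearMap.linearIndependent_iff_of_injOn φ hφ.injOn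
  have h2 : LinearIndepOn K v I ↔ LinearIndependent K u := by
    have h : (fun x : I => v (x : α)) =
        (Submodule.subtype (span K (range fun x : B => v (x : α)))) ∘ u := rfl
    unfold LinearIndepOn
    rw [h]
    exact LinearMap.linearIndependent_iff_of_injOn _ (Submodule.injective_subtype _).injOn
  rw [h1, h2]

/-- The restriction of a vector matroid to `R ⊆ E` is the vector matroid of the same family on `R`
(Oxley 3.1.2: `M[A] \ T` is represented by deleting the columns in `T`). [cite: Oxley2011, 3.1.2] -/
theorem vectorMatroid_restrict (v : α → W) {E R : Set α} (hR : R ⊆ E) :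
    (vectorMatroid K v E).restrict R = vectorMatroid K v R := by
  refine Matroid.ext_indep rfl fun I _ => ?_
  simp only [Matroid.restrict_indep_iff, vectorMatroid_indep_iff]
  exact ⟨fun h => ⟨h.2, h.1.2⟩, fun h => ⟨⟨h.1.trans hR, h.2⟩, h.1⟩⟩

/-- Restrictions of representable matroids are representable (Oxley 3.1.2).
[cite: Oxley2011, 3.1.2] -/
theorem IsRepresentable.restrict {M : Matroid α} (h : IsRepresentable K M) {R : Set α}
    (hR : R ⊆ M.E) : IsRepresentable K (M.restrict R) := by
  obtain ⟨v, hv⟩ := h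
  refine ⟨v, ?_⟩
  rw [Matroid.restrict_ground_eq, ← hv]
  exact (vectorMatroid_restrict v hR).symm

/-- Deletions of representable matroids are representable (Oxley 3.1.2).
[cite: Oxley2011, 3.1.2] -/
theorem IsRepresentable.delete {M : Matroid α} (h : IsRepresentable K M) (D : Set α) :
    IsRepresentable K (M.delete D) := by
  rw [Matroid.delete_eq_restrict]
  exact h.restrict sdiff_subset

/-! ### Contraction and minors (Prop. 3.2.6, Prop. 3.2.4) -/

/-- **Contraction = projection from the span of the contracted set** (the coordinate-free form of Oxley
Prop. 3.2.6, `M[A]/e = M[A'/e]`): for `T ⊆ E`, the contraction `(vectorMatroid K v E) / T` is the vector matroid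
of the images of the `v e` in the quotient space `W ⧸ span (v '' T)`, on `E ∖ T`.  (A basis `B` of `T` has
`span (v '' B) = span (v '' T)`, and `J ∪ B` is linearly independent iff `B` is and `J` is independent modulo
`span (v '' B)` — Mathlib's `linearIndepOn_union_iff_quotient`.) [cite: Oxley2011, Prop. 3.2.6] -/
theorem vectorMatroid_contract (v : α → W) {E T : Set α} (hT : T ⊆ E) :
    (vectorMatroid K v E).contract T =
      vectorMatroid K (Submodule.mkQ (span K (v '' T)) ∘ v) (E \ T) := by
  obtain ⟨B, hB⟩ := (vectorMatroid K v E).exists_isBasis T hT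
  have hBli : LinearIndepOn K v B := ((vectorMatroid_indep_iff v E).1 hB.indep).2
  refine Matroid.ext_indep rfl fun J (hJ : J ⊆ E \ T) => ?_
  have hTJ : Disjoint T J := (subset_sdiff.1 hJ).2.symm
  rw [hB.contract_indep_iff, vectorMatroid_indep_iff, vectorMatroid_indep_iff, and_iff_left hTJ,
    union_comm, linearIndepOn_union_iff_quotient (hTJ.mono_left hB.subset), and_iff_right hBli,
    ← span_image_eq_of_isBasis v E hB]
  exact ⟨fun h => ⟨hJ, h.2⟩,
    fun h => ⟨union_subset (hB.subset.trans hT) (hJ.trans sdiff_subset), h.2⟩⟩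

/-- Contractions of representable matroids are representable (Oxley Prop. 3.2.4, via Prop. 3.2.6).
[cite: Oxley2011, Prop. 3.2.4] -/
theorem IsRepresentable.contract {M : Matroid α} (h : IsRepresentable K M) (T : Set α) :
    IsRepresentable K (M.contract T) := by
  obtain ⟨v, hv⟩ := h
  rw [← Matroid.contract_inter_ground_eq, ← hv, vectorMatroid_ground,
    vectorMatroid_contract v inter_subset_right]
  exact vectorMatroid_isRepresentable _ _

/-- **Oxley, Proposition 3.2.4.** "Every minor of an `𝔽`-representable matroid is `𝔽`-representable."
[cite: Oxley2011, Prop. 3.2.4] -/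
theorem IsRepresentable.minor {N M : Matroid α} (h : IsRepresentable K M) (hNM : N ≤m M) :
    IsRepresentable K N := by
  obtain ⟨C, D, rfl⟩ := (hNM : ∃ C D, N = (M.contract C).delete D)
  exact (h.contract C).delete D

/-! ### `U_{0,n}`, `U_{1,n}` and `U_{n,n}` are representable over every `K` -/

/-- The zero family represents `U_{0,E}` (all elements loops). [cite: Oxley2011, §6.5 p. 206] -/
theorem vectorMatroid_zero_eq_unifOn_zero (E : Set α) :
    vectorMatroid K (0 : α → W) E = unifOn E 0 := by
  refine Matroid.ext_indep rfl fun I (_ : I ⊆ E) => ?_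
  rw [vectorMatroid_indep_iff, unifOn_indep_iff, Nat.cast_zero, nonpos_iff_eq_zero, encard_eq_zero]
  refine and_congr_right fun _ => ⟨fun h => ?_, fun h => ?_⟩
  · by_contra hne
    obtain ⟨x, hx⟩ := nonempty_iff_ne_empty.2 hne
    exact (linearIndepOn_singleton_iff K).1 (h.mono (singleton_subset_iff.2 hx)) rfl
  · rw [h]
    exact linearIndepOn_empty K _

/-- A constant non-zero family represents `U_{1,E}`. [cite: Oxley2011, §6.5 p. 206] -/
theorem vectorMatroid_const_eq_unifOn_one {w : W} (hw : w ≠ 0) (E : Set α) :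
    vectorMatroid K (fun _ : α => w) E = unifOn E 1 := by
  refine Matroid.ext_indep rfl fun I (_ : I ⊆ E) => ?_
  rw [vectorMatroid_indep_iff, unifOn_indep_iff, Nat.cast_one]
  refine and_congr_right fun _ => ⟨fun h => ?_, fun h => ?_⟩
  · by_contra hlt
    rw [not_le] at hlt
    obtain ⟨a, b, ha, hb, hab⟩ := one_lt_encard_iff.1 hlt
    have hab' : a ∉ ({b} : Set α) := by simpa using hab
    have h2 := ((linearIndepOn_insert hab').1 (h.mono (pair_subset ha hb))).2
    exact h2 (subset_span ⟨b, rfl, rfl⟩)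
  · rcases encard_le_one_iff_eq.1 h with rfl | ⟨x, rfl⟩
    · exact linearIndepOn_empty K _
    · exact (linearIndepOn_singleton_iff K).2 hw

/-- The standard basis vectors represent the free matroid `U_{n,n}` (`M[I_n]`).
[cite: Oxley2011, §1.1 p. 12] -/
theorem vectorMatroid_single_eq_freeOn [DecidableEq α] (E : Set α) :
    vectorMatroid K (fun e : α => (Pi.single e 1 : α → K)) E = Matroid.freeOn E := by
  refine Matroid.ext_indep rfl fun I (_ : I ⊆ E) => ?_
  rw [vectorMatroid_indep_iff, Matroid.freeOn_indep_iff, and_iff_left_iff_imp]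
  exact fun _ => (linearIndepOn_univ_iff.2 (Pi.linearIndependent_single_one α K)).mono (subset_univ I)

/-- `U_{0,E}` is representable over every `K`. [cite: Oxley2011, §6.5 p. 206] -/
theorem unifOn_zero_isRepresentable (E : Set α) : IsRepresentable K (unifOn E 0) :=
  ⟨0, vectorMatroid_zero_eq_unifOn_zero E⟩

/-- `U_{1,E}` is representable over every `K`. [cite: Oxley2011, §6.5 p. 206] -/
theorem unifOn_one_isRepresentable (E : Set α) : IsRepresentable K (unifOn E 1) := by
  have h := vectorMatroid_isRepresentable (K := K) (fun _ : α => (1 : K)) E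
  rwa [vectorMatroid_const_eq_unifOn_one one_ne_zero] at h

/-- The free matroid is representable over every `K`. [cite: Oxley2011, §1.1 p. 12] -/
theorem freeOn_isRepresentable (E : Set α) : IsRepresentable K (Matroid.freeOn E) := by
  classical
  exact ⟨fun e => Pi.single e 1, vectorMatroid_single_eq_freeOn E⟩

/-- `U_{m,E}` with `|E| ≤ m` (a free matroid) is representable over every `K`.
[cite: Oxley2011, §1.1 p. 12] -/
theorem unifOn_isRepresentable_of_encard_le {E : Set α} {m : ℕ} (h : E.encard ≤ m) :
    IsRepresentable K (unifOn E m) := by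
  rw [unifOn_eq_freeOn h]
  exact freeOn_isRepresentable E

/-! ### The necessary condition: `U_{2,E}` over a finite field forces `|E| ≤ |𝔽| + 1` -/

/-- In a vector representation of `U_{2,E}`, sets of size `≤ 2` inside `E` are linearly
independent and linearly independent subsets of `E` have size `≤ 2`. [folklore] -/
private theorem linearIndepOn_iff_of_eq_unifOn_two {v : α → W} {E I : Set α}
    (h : vectorMatroid K v E = unifOn E 2) (hIE : I ⊆ E) : LinearIndepOn K v I ↔ I.encard ≤ 2 := by
  have h1 : (vectorMatroid K v E).Indep I ↔ I ⊆ E ∧ LinearIndepOn K v I :=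
    vectorMatroid_indep_iff v E
  rw [h, unifOn_indep_iff, Nat.cast_ofNat] at h1
  exact ⟨fun hI => (h1.2 ⟨hIE, hI⟩).2, fun hI => (h1.1 ⟨hIE, hI⟩).2⟩

end IsRepresentable

section RankTwo

variable {α 𝔽 W : Type*} [Field 𝔽] [AddCommGroup W] [Module 𝔽 W]

/-- **`U_{2,k}` over `GF(q)` needs `k ≤ q + 1`** (Oxley Prop. 6.5.2, necessity): if `U_{2,E}` is the
vector matroid of `v` over a finite field `𝔽`, then `|E| ≤ |𝔽| + 1`.  Proof: for `a ≠ b` in `E`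
every `v e`, `e ∈ E`, lies in the plane `P = ⟨v a, v b⟩` (triples are dependent), is non-zero, and
distinct elements give distinct points `⟨v e⟩` of the projective line `ℙ(P)`, which has `|𝔽| + 1`
points. [cite: Oxley2011, Prop. 6.5.2] -/
theorem encard_le_of_vectorMatroid_eq_unifOn_two [Finite 𝔽] {v : α → W} {E : Set α}
    (h : vectorMatroid 𝔽 v E = unifOn E 2) : E.encard ≤ Nat.card 𝔽 + 1 := by
  classical
  rcases le_or_gt E.encard 1 with hE1 | hE1
  · exact hE1.trans le_add_self
  obtain ⟨a, b, ha, hb, hab⟩ := one_lt_encard_iff.1 hE1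
  have hab' : ({a, b} : Set α) ⊆ E := pair_subset ha hb
  have hliab : LinearIndepOn 𝔽 v {a, b} :=
    (linearIndepOn_iff_of_eq_unifOn_two h hab').2 (encard_pair hab).le
  set P : Submodule 𝔽 W := span 𝔽 (v '' {a, b}) with hP
  -- every `v e`, `e ∈ E`, lies in the plane `P`
  have hvP : ∀ e ∈ E, v e ∈ P := by
    intro e he
    by_cases heab : e ∈ ({a, b} : Set α)
    · exact subset_span (mem_image_of_mem v heab)
    · by_contra hcon
      have hli3 : LinearIndepOn 𝔽 v (insert e {a, b}) :=
        (linearIndepOn_insert heab).2 ⟨hliab, hcon⟩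
      have h3 := (linearIndepOn_iff_of_eq_unifOn_two h (insert_subset he hab')).1 hli3
      rw [encard_insert_of_notMem heab, encard_pair hab] at h3
      exact absurd h3 (by norm_num)
  have hv0 : ∀ e ∈ E, v e ≠ 0 := fun e he =>
    (linearIndepOn_singleton_iff 𝔽).1
      ((linearIndepOn_iff_of_eq_unifOn_two h (singleton_subset_iff.2 he)).2 (by simp))
  -- `P` is a plane
  have hP2 : Module.finrank 𝔽 P = 2 := by
    have h1 : (vectorMatroid 𝔽 v E).eRk {a, b} = Module.finrank 𝔽 P :=
      eRk_vectorMatroid_eq_finrank_span v E hab' (toFinite _)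
    rw [h, unifOn_eRk_eq_encard hab' (by rw [encard_pair hab, Nat.cast_ofNat]),
      encard_pair hab] at h1
    exact_mod_cast h1.symm
  haveI : Module.Finite 𝔽 P := Module.finite_of_finrank_eq_succ hP2
  haveI : Finite P := Module.finite_of_finite 𝔽
  -- the injection `E ↪ ℙ(P)`
  let f : E → Projectivization 𝔽 P := fun e =>
    Projectivization.mk 𝔽 (⟨v e, hvP e e.2⟩ : P) (fun h0 => hv0 e e.2 (congrArg Subtype.val h0))
  have hf : Function.Injective f := by
    intro e e' hee'
    by_contra hne
    have hne' : (e : α) ≠ e' := fun h' => hne (Subtype.ext h')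
    obtain ⟨c, hc⟩ := (Projectivization.mk_eq_mk_iff 𝔽 _ _ _ _).1 hee'
    have hc' : (c : 𝔽) • v e' = v e := by
      have := congrArg Subtype.val hc
      simpa [Units.smul_def] using this
    have hli2 : LinearIndepOn 𝔽 v (insert (e : α) {(e' : α)}) :=
      (linearIndepOn_iff_of_eq_unifOn_two h (pair_subset e.2 e'.2)).2 (encard_pair hne').le
    have h2 := ((linearIndepOn_insert (by simpa using hne')).1 hli2).2
    rw [image_singleton] at h2
    exact h2 (mem_span_singleton.2 ⟨(c : 𝔽), hc'⟩)
  haveI : Finite E := Finite.of_injective f hf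
  have hcard : Nat.card E ≤ Nat.card 𝔽 + 1 := by
    rw [← Projectivization.card_of_finrank_two 𝔽 P hP2]
    exact Nat.card_le_card_of_injective f hf
  rw [← (toFinite E).cast_ncard_eq, ← Nat.card_coe_set_eq]
  exact_mod_cast hcard

/-- A `𝔽`-representable `U_{2,E}` over a finite field has `|E| ≤ |𝔽| + 1` (Oxley Prop. 6.5.2,
necessity). [cite: Oxley2011, Prop. 6.5.2] -/
theorem IsRepresentable.encard_le_of_unifOn_two [Finite 𝔽] {E : Set α}
    (h : IsRepresentable 𝔽 (unifOn E 2)) : E.encard ≤ Nat.card 𝔽 + 1 := by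
  obtain ⟨v, hv⟩ := h
  exact encard_le_of_vectorMatroid_eq_unifOn_two hv

/-! ### The sufficient condition: an explicit representation -/

/-- The representing vectors of `U_{2,E}`: `(0,1)` at the distinguished element `a` and `(1, c e)`
elsewhere (the `|𝔽| + 1` points of the projective line `PG(1, 𝔽)`).
[cite: Oxley2011, Prop. 6.5.2] -/
def lineVectors [DecidableEq α] (a : α) (c : α → 𝔽) : α → (Fin 2 → 𝔽) :=
  fun e => if e = a then ![0, 1] else ![1, c e]

omit [Field 𝔽] in
/-- `lineVectors a c a = (0, 1)`. [cite: Oxley2011, Prop. 6.5.2] -/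
@[simp] theorem lineVectors_self [Field 𝔽] [DecidableEq α] (a : α) (c : α → 𝔽) :
    lineVectors a c a = ![0, 1] := if_pos rfl

omit [Field 𝔽] in
/-- `lineVectors a c e = (1, c e)` for `e ≠ a`. [cite: Oxley2011, Prop. 6.5.2] -/
theorem lineVectors_of_ne [Field 𝔽] [DecidableEq α] {a e : α} (c : α → 𝔽) (h : e ≠ a) :
    lineVectors a c e = ![1, c e] := if_neg h

/-- The vectors `lineVectors a c e` are non-zero. [folklore] -/
private theorem lineVectors_ne_zero [DecidableEq α] (a : α) (c : α → 𝔽) (e : α) :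
    lineVectors a c e ≠ 0 := by
  intro h0
  by_cases he : e = a
  · subst he
    have := congrFun h0 1
    simp at this
  · rw [lineVectors_of_ne c he] at h0
    have := congrFun h0 0
    simp at this

/-- Two of the vectors `lineVectors a c` at distinct elements of `E` are linearly independent when
`c` is injective on `E \ {a}`. [folklore] -/
private theorem lineVectors_pair [DecidableEq α] {a : α} {c : α → 𝔽} {E : Set α}
    (hc : InjOn c (E \ {a})) {x y : α} (hx : x ∈ E) (hy : y ∈ E) (hxy : x ≠ y) :
    LinearIndepOn 𝔽 (lineVectors a c) {x, y} := by
  have hxy' : x ∉ ({y} : Set α) := by simpa using hxy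
  refine (linearIndepOn_insert hxy').2
    ⟨(linearIndepOn_singleton_iff 𝔽).2 (lineVectors_ne_zero a c y), fun hmem => ?_⟩
  rw [image_singleton] at hmem
  obtain ⟨t, ht⟩ := mem_span_singleton.1 hmem
  have h0 := congrFun ht 0
  have h1 := congrFun ht 1
  by_cases hya : y = a
  · subst hya
    rw [lineVectors_self, lineVectors_of_ne c hxy] at h0
    simp at h0
  by_cases hxa : x = a
  · subst hxa
    rw [lineVectors_self, lineVectors_of_ne c hya] at h0 h1
    simp only [Pi.smul_apply, smul_eq_mul, Matrix.cons_val_zero, mul_one] at h0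
    simp [h0] at h1
  rw [lineVectors_of_ne c hxa, lineVectors_of_ne c hya] at h0 h1
  simp only [Pi.smul_apply, smul_eq_mul, Matrix.cons_val_zero, mul_one] at h0
  simp only [h0, Pi.smul_apply, smul_eq_mul, one_mul, Matrix.cons_val_one,
    Matrix.cons_val_fin_one] at h1
  exact hxy (hc ⟨hx, hxa⟩ ⟨hy, hya⟩ h1.symm)

/-- **The `|𝔽| + 1` points of `PG(1, 𝔽)` carry `U_{2,|𝔽|+1}`** (Oxley Prop. 6.5.2, sufficiency):
if `c` is injective on `E \ {a}`, the vectors `lineVectors a c` represent `U_{2,E}`.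
[cite: Oxley2011, Prop. 6.5.2] -/
theorem vectorMatroid_lineVectors [DecidableEq α] {a : α} {c : α → 𝔽} {E : Set α}
    (hc : InjOn c (E \ {a})) : vectorMatroid 𝔽 (lineVectors a c) E = unifOn E 2 := by
  refine Matroid.ext_indep rfl fun I (_ : I ⊆ E) => ?_
  rw [vectorMatroid_indep_iff, unifOn_indep_iff, Nat.cast_ofNat]
  refine and_congr_right fun hIE => ⟨fun h => ?_, fun h => ?_⟩
  · have h2 : (Module.rank 𝔽 (Fin 2 → 𝔽)).toENat = 2 := by
      rw [rank_fin_fun]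
      simp
    exact h2 ▸ h.encard_le_toENat_rank
  · rcases le_or_gt I.encard 1 with h1 | h1
    · rcases encard_le_one_iff_eq.1 h1 with rfl | ⟨x, rfl⟩
      · exact linearIndepOn_empty 𝔽 _
      · exact (linearIndepOn_singleton_iff 𝔽).2 (lineVectors_ne_zero a c x)
    · have h2 : I.encard = 2 := le_antisymm h (Order.add_one_le_of_lt h1)
      obtain ⟨x, y, hxy, rfl⟩ := encard_eq_two.1 h2
      exact lineVectors_pair hc (hIE (by simp)) (hIE (by simp)) hxy

/-- A finite set not larger than `K` admits a function injective on it with values in `K`.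
[folklore] -/
private theorem exists_injOn_of_encard_le {K : Type*} [Zero K] {S : Set α} (hS : S.Finite)
    (h : S.encard ≤ ENat.card K) : ∃ c : α → K, InjOn c S := by
  classical
  haveI : Fintype S := hS.fintype
  obtain ⟨φ⟩ : Nonempty (S ↪ K) := by
    rcases finite_or_infinite K with hK | hK
    · haveI := Fintype.ofFinite K
      refine Function.Embedding.nonempty_iff_card_le.2 ?_
      rw [ENat.card_eq_coe_fintype_card, encard_eq_coe_toFinset_card, toFinset_card,
        Nat.cast_le] at h
      exact h
    · exact ⟨(Fintype.equivFin S).toEmbedding.trans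
        (Fin.valEmbedding.trans (Infinite.natEmbedding K))⟩
  refine ⟨fun x => if hx : x ∈ S then φ ⟨x, hx⟩ else 0, fun x hx y hy hxy => ?_⟩
  simp only [dif_pos hx, dif_pos hy] at hxy
  exact congrArg Subtype.val (φ.injective hxy)

/-- **`U_{2,k}` is `𝔽`-representable when `|𝔽| ≥ k - 1`** (Oxley Prop. 6.5.2, sufficiency), for a
finite `E` with `E.encard ≤ ENat.card 𝔽 + 1`. [cite: Oxley2011, Prop. 6.5.2] -/
theorem unifOn_two_isRepresentable_of_encard_le {E : Set α} (hE : E.Finite)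
    (h : E.encard ≤ ENat.card 𝔽 + 1) : IsRepresentable 𝔽 (unifOn E 2) := by
  classical
  rcases E.eq_empty_or_nonempty with rfl | ⟨a, ha⟩
  · exact unifOn_isRepresentable_of_encard_le (by simp)
  have hS : (E \ {a}).encard ≤ ENat.card 𝔽 := by
    rw [← encard_sdiff_singleton_add_one ha] at h
    exact WithTop.le_of_add_le_add_right ENat.one_ne_top h
  obtain ⟨c, hc⟩ := exists_injOn_of_encard_le (K := 𝔽) (hE.subset sdiff_subset) hS
  have hrep := vectorMatroid_isRepresentable (K := 𝔽) (lineVectors a c) E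
  rwa [vectorMatroid_lineVectors hc] at hrep

/-- **Oxley, Proposition 6.5.2.** Let `𝔽` be a field and `E` a finite set (`|E| = k`).  Then
`U_{2,k}` is `𝔽`-representable if and only if `|𝔽| ≥ k - 1`, i.e. `E.encard ≤ ENat.card 𝔽 + 1`
(automatic for infinite `𝔽`).  (Oxley assumes `k ≥ 2`; for `k ≤ 1` both sides hold.)
[cite: Oxley2011, Prop. 6.5.2] -/
theorem unifOn_two_isRepresentable_iff {E : Set α} (hE : E.Finite) :
    IsRepresentable 𝔽 (unifOn E 2) ↔ E.encard ≤ ENat.card 𝔽 + 1 := by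
  refine ⟨fun h => ?_, unifOn_two_isRepresentable_of_encard_le hE⟩
  rcases finite_or_infinite 𝔽 with h𝔽 | h𝔽
  · rw [ENat.card_eq_coe_natCard]
    exact h.encard_le_of_unifOn_two
  · rw [ENat.card_eq_top_of_infinite, top_add]
    exact le_top

/-- Proposition 6.5.2 over a finite field `GF(q)`, for an arbitrary ground set `E`:
`U_{2,E}` is `GF(q)`-representable iff `|E| ≤ q + 1`. [cite: Oxley2011, Prop. 6.5.2] -/
theorem unifOn_two_isRepresentable_iff_of_finite [Finite 𝔽] {E : Set α} :
    IsRepresentable 𝔽 (unifOn E 2) ↔ E.encard ≤ Nat.card 𝔽 + 1 := by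
  refine ⟨fun h => h.encard_le_of_unifOn_two, fun h => ?_⟩
  have hE : E.Finite := finite_of_encard_le_coe (h.trans_eq (by norm_cast))
  exact unifOn_two_isRepresentable_of_encard_le hE (by rwa [ENat.card_eq_coe_natCard])

/-- Over an infinite field every finite `U_{2,k}` is representable. [cite: Oxley2011, Prop. 6.5.2] -/
theorem unifOn_two_isRepresentable_of_infinite [Infinite 𝔽] {E : Set α} (hE : E.Finite) :
    IsRepresentable 𝔽 (unifOn E 2) :=
  (unifOn_two_isRepresentable_iff hE).2 (by rw [ENat.card_eq_top_of_infinite, top_add]; exact le_top)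

/-- **Oxley, Corollary 6.5.3 (size part).** Over the finite field `𝔽 = GF(q)`, the matroid
`U_{2,q+2}` is not `𝔽`-representable, while each single-element deletion `U_{2,q+2} \ e ≅ U_{2,q+1}`
and contraction `U_{2,q+2} / e ≅ U_{1,q+1}` is.  (Together with the minor-closedness of
representability, Oxley Prop. 3.2.4, this says `U_{2,q+2}` is an excluded minor for
`GF(q)`-representability; the dual statement for `U_{q,q+2}` uses Cor. 2.2.9.)
[cite: Oxley2011, Cor. 6.5.3] -/
theorem unifOn_two_not_isRepresentable_and_minors [Finite 𝔽] {E : Set α}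
    (hE : E.encard = Nat.card 𝔽 + 2) :
    ¬ IsRepresentable 𝔽 (unifOn E 2) ∧
      ∀ e ∈ E, IsRepresentable 𝔽 ((unifOn E 2).delete {e}) ∧
        IsRepresentable 𝔽 ((unifOn E 2).contract {e}) := by
  have hEfin : E.Finite := finite_of_encard_eq_coe (hE.trans (by norm_cast))
  refine ⟨fun h => ?_, fun e he => ⟨?_, ?_⟩⟩
  · have h' := h.encard_le_of_unifOn_two
    rw [hE] at h'
    exact absurd h' (by
      rw [not_le]
      exact_mod_cast Nat.lt_succ_self (Nat.card 𝔽 + 1))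
  · rw [unifOn_delete]
    refine unifOn_two_isRepresentable_of_encard_le (hEfin.subset sdiff_subset) ?_
    have h1 := encard_sdiff_singleton_add_one he
    rw [hE, ENat.card_eq_coe_natCard] at *
    have h2 : (E \ {e}).encard = Nat.card 𝔽 + 1 := by
      have hfin : (E \ {e}).encard ≠ ⊤ := (hEfin.subset sdiff_subset).encard_lt_top.ne
      lift (E \ {e}).encard to ℕ using hfin with n hn
      norm_cast at h1 ⊢
      omega
    exact h2.le
  · rw [unifOn_contract_singleton he]
    exact unifOn_one_isRepresentable _

/-! ### Corollary 6.5.3: `U_{2,q+2}` is an excluded minor -/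

/-- **Proper minors sit below a single-element deletion or contraction**: a proper (strict) minor `N = M/Y \ X`
(`X ∪ Y ≠ ∅`, Oxley §3.1 p. 101) of `M` is a minor of `M/e` or of `M \ e` for some `e ∈ E(M)`.
[cite: Oxley2011, §3.1 (p. 101)] -/
theorem _root_.Matroid.IsStrictMinor.exists_isMinor_contract_or_delete {N M : Matroid α} (h : N <m M) :
    ∃ e ∈ M.E, N ≤m M.contract {e} ∨ N ≤m M.delete {e} := by
  obtain ⟨C, D, hC, hD, -, rfl⟩ := h.isMinor.exists_eq_contract_delete_disjoint
  rcases C.eq_empty_or_nonempty with rfl | ⟨e, he⟩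
  · rcases D.eq_empty_or_nonempty with rfl | ⟨e, he⟩
    · exact (h.ne (by rw [Matroid.contract_empty, Matroid.delete_empty])).elim
    · refine ⟨e, hD he, Or.inr ⟨∅, D \ {e}, ?_⟩⟩
      rw [Matroid.contract_empty, Matroid.contract_empty, Matroid.delete_delete]
      congr 1
      exact Set.ext fun x => by by_cases hx : x = e <;> simp [hx, he]
  · refine ⟨e, hC he, Or.inl ⟨C \ {e}, D, ?_⟩⟩
    rw [Matroid.contract_contract]
    congr 2
    exact Set.ext fun x => by by_cases hx : x = e <;> simp [hx, he]

/-- **Oxley, Corollary 6.5.3** (for `U_{2,q+2}`): over the finite field `𝔽 = GF(q)` the matroid `U_{2,q+2}` is an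
excluded minor for `𝔽`-representability — it is not `𝔽`-representable, and every proper minor of it is.
(The statement for `U_{q,q+2}` follows by duality, Lemma 6.5.1 / Cor. 2.2.9.) [cite: Oxley2011, Cor. 6.5.3] -/
theorem unifOn_two_isExcludedMinor [Finite 𝔽] {E : Set α} (hE : E.encard = Nat.card 𝔽 + 2) :
    ¬ IsRepresentable 𝔽 (unifOn E 2) ∧ ∀ N : Matroid α, N <m unifOn E 2 → IsRepresentable 𝔽 N := by
  refine ⟨(unifOn_two_not_isRepresentable_and_minors hE).1, fun N hN => ?_⟩
  obtain ⟨e, he, h | h⟩ := hN.exists_isMinor_contract_or_delete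
  · exact ((unifOn_two_not_isRepresentable_and_minors hE).2 e he).2.minor h
  · exact ((unifOn_two_not_isRepresentable_and_minors hE).2 e he).1.minor h

end RankTwo

end Literature.Combinatorics.Matroid
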